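import Summits.PneNP.PneNP.Theorems.SoloBlindCorridorMap
import Summits.PneNP.PneNP.Theorems.SoloBlindEquivalentForms
import Literature.Computability.Complexity.TotalSearchProblem
import Literature.Computability.Complexity.ComplementTranslation
import Literature.Computability.Cryptography.CryptoFoundationsOneWayFunctionsProofs
import Literature.Computability.Cryptography.OneWayFunctionsPPoly
import Literature.Computability.FineGrained.CliqueETHProofs
import HarnessLib

/-!
# Solo (blind) — corridor map, part 2: the cryptographic, total-search, fine-grained and
exponential-padding entrances, wired to the summit constant

Continuation of `SoloBlindCorridorMap.lean`: the remaining classical SUFFICIENT hypotheses for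
`Summit.PneNP` (`= ∃ L ∈ NP, L ∉ P`), each assembled from PROVED theorems of the tree's
Literature library (no named fact is assumed), so that for every corridor "where it breaks" is the
open HYPOTHESIS, never the bridge.

* §I cryptography: `pneNP_of_isOneWay` — ONE (standard, average-case, uniform-adversary) one-way
  function gives `P ≠ NP` (Goldreich 2001 §2.7.4 Ex. 2, tree `not_isOneWay_of_NP_subset_P`);
  `pneNP_of_nonuniformOWFExist` — a one-way function against non-uniform adversaries gives
  `NP ⊄ P/poly` (tree `NP_not_subset_PPoly_of_NonuniformOWFExist`) and hence the summit.
* §J total search problems: `pneNP_of_not_solvableInFP` — a total, polynomially balanced,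
  `P`-checkable search problem (a `TFNP` problem: FACTORING, NASH, PIGEON, …) that no `FP` function
  solves gives `P ≠ NP` (Megiddo–Papadimitriou 1991, tree `not_NP_subset_P_of_not_solvableInFP`).
* §D fine-grained: `pneNP_of_SETH`, `pneNP_of_ETHWordRAM` (tree `P_ne_NP_of_seth_holds`,
  `P_ne_NP_of_ethWordRAM`), next to `pneNP_of_ETH` of part 1.
* §A/§D exponential padding (Book 1974): `pneNP_of_co_NE_ne_NE` — `NE ≠ coNE ⟹ NP ≠ coNP ⟹ P ≠ NP`
  (tree `NP_ne_coNP_of_co_NE_ne_NE`), and `pneNP_of_co_NEXP_ne_NEXP`.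
-/

namespace Summit.PneNP.PneNP.Theorems.SoloBlind

open Computability
open Literature.Computability.Complexity Literature.Computability.Cryptography
open Literature.Computability.FineGrained

/-! ### §I — cryptography -/

/-- **One one-way function gives `P ≠ NP`.** If some `f` is one-way in the standard sense
(`IsOneWay`: polynomial-time computable, and every probabilistic polynomial-time inverter succeeds
with negligible probability), then `P ≠ NP` (via the tree's `not_isOneWay_of_NP_subset_P`).
[cite: Goldreich2001, §2.7.4 Exercise 2] -/
theorem pneNP_of_isOneWay {f : List Bool → List Bool} (hf : IsOneWay f) : PneNP :=
  pneNP_iff_not_NP_subset_P.2 fun hNP => not_isOneWay_of_NP_subset_P hNP f hf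

/-- **A one-way function secure against non-uniform adversaries gives `P ≠ NP`**, through
`NP ⊄ P/poly` (tree `NP_not_subset_PPoly_of_NonuniformOWFExist`) and `P ⊆ P/poly`.
[cite: Goldreich2001, §2.7.4 Exercise 2] [cite: AroraBarak2009, Def. 6.16 (remark `P ⊆ P/poly`)] -/
theorem pneNP_of_nonuniformOWFExist (h : NonuniformOWFExist) : PneNP :=
  pneNP_of_not_NP_subset_PPoly (NP_not_subset_PPoly_of_NonuniformOWFExist h)

/-! ### §J — total search problems -/

/-- **A hard `TFNP` problem gives `P ≠ NP`.** A search problem `R` whose relation is in `P`, which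
is polynomially balanced and total, and which no polynomial-time function solves, yields the
summit (via the tree's `not_NP_subset_P_of_not_solvableInFP`).
[cite: MegiddoPapadimitriou1991, p. 318] -/
theorem pneNP_of_not_solvableInFP {R : SearchProblem} (hrel : R.rel ∈ Classes.P)
    (hb : R.IsPolyBalanced) (ht : R.IsTotal) (hX : ¬ R.SolvableInFP) : PneNP :=
  pneNP_iff_not_NP_subset_P.2 (SearchProblem.not_NP_subset_P_of_not_solvableInFP hrel hb ht hX)

/-! ### §D — fine-grained hypotheses -/

/-- **`SETH ⟹ P ≠ NP`** (via the tree's `P_ne_NP_of_seth_holds`).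
[cite: ImpagliazzoPaturi2001, §1 (SETH ⟹ ETH ⟹ P ≠ NP)] -/
theorem pneNP_of_SETH (h : SETH) : PneNP :=
  pneNP_iff_P_ne_NP.2 (P_ne_NP_of_seth_holds h)

/-- **Word-RAM `ETH ⟹ P ≠ NP`** (via the tree's `P_ne_NP_of_ethWordRAM`).
[cite: ImpagliazzoPaturi2001, §1] -/
theorem pneNP_of_ETHWordRAM (h : ETHWordRAM) : PneNP :=
  pneNP_iff_P_ne_NP.2 (P_ne_NP_of_ethWordRAM h)

/-! ### §A/§D — exponential padding (Book 1974) -/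

/-- **`NE ≠ coNE ⟹ P ≠ NP`**: downward separation `NE ≠ coNE ⟹ NP ≠ coNP` (Book 1974; tree
`NP_ne_coNP_of_co_NE_ne_NE`) followed by `NP ≠ coNP ⟹ P ≠ NP` (part 1).
[cite: Book1974, Theorem 1 (p. 189)] -/
theorem pneNP_of_co_NE_ne_NE (h : co NE ≠ NE) : PneNP :=
  pneNP_of_NP_ne_coNP (NP_ne_coNP_of_co_NE_ne_NE h)

/-- **`NEXP ≠ coNEXP ⟹ P ≠ NP`** (tree `co_NE_ne_NE_of_co_NEXP_ne_NEXP`, then the previous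
bridge). [cite: Book1974, Theorem 1 (p. 189)] -/
theorem pneNP_of_co_NEXP_ne_NEXP (h : co NEXP ≠ NEXP) : PneNP :=
  pneNP_of_co_NE_ne_NE (co_NE_ne_NE_of_co_NEXP_ne_NEXP h)

end Summit.PneNP.PneNP.Theorems.SoloBlind
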